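import Literature.MathematicalPhysics.QuantumFieldTheory.MassGapFromLatticeClustering
import Literature.MathematicalPhysics.QuantumFieldTheory.OSTransferSelfImprovement
import HarnessLib

/-!
# The full-spectrum mass gap of OS data from DIAGONAL exponential bounds with free constants

Topic `MathematicalPhysics/QuantumFieldTheory` (families `constructive-qft`, `yang-mills`); theorem-only
sequel of `MassGapFromSpanClustering` / `MassGapFromLatticeClustering` and `OSTransferSelfImprovement`.

`OSData.HasMassGap T Δ` (Jaffe–Witten's "`H` has no spectrum in `(0, Δ)`" on the FULL reconstructed
space) is reduced by `OSData.hasMassGap_of_csBound_span` to the Cauchy–Schwarz bound with the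
reflection-positive norms on the spans of slab-ordered real product tensors — a bound whose constant is
CONTINUOUS in the pair of test functions.  This file removes the continuity requirement altogether:

* `OSData.hasMassGap_of_diagBound` — it suffices that for every arity `n ≥ 1`, every label string `k`
  and every SINGLE slab-ordered real product tensor `P` there is SOME constant `C(P)` with the
  DIAGONAL bound `‖𝔖₂ₙ^{rev k ++ k}(ΘP* ⊗ T_t P) − 𝔖ₙ^{rev k}(ΘP*) 𝔖ₙ^{k}(P)‖ ≤ C(P) e^{−Δt}` for
  `t ≥ 0` (no Cauchy–Schwarz form, no finite families, no continuity in `P`).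

Proof (Osterwalder–Schrader 1973, §4.1; Glimm–Jaffe 1987, Thm. 6.1.3): inside the OS Hilbert space of
`T` (`OSReconstructionNoE1`) the diagonal quantity is `⟨v, e^{−tH} v⟩` for `v = Ψ_P − ⟨Ω, Ψ_P⟩Ω`; it
is `≥ 0` and log-convex in `t` with INFINITE horizon, so a bound `C e^{−Δt}` with ANY constant
self-improves to `‖v‖² e^{−Δt}` (`OSTransferSelfImprovement`); vectors with the improved bound form
a subspace, and on it `|⟨v, e^{−tH} w⟩| ≤ e^{−Δt} ‖v‖ ‖w‖ ≤ e^{−Δt} ‖Ψ_F‖ ‖Ψ_G‖` — exactly the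
hypothesis of `OSData.hasMassGap_of_csBound_span`.

* Lattice-facing corollary `OSData.hasMassGap_of_tendsto_of_diagBound`: if lattice `n`-point
  functions `Λ k` converge to `𝔖` on off-diagonal real product tensors (the convergence clause of
  `IsYangMillsFor` / `IsQCDAlong`) and satisfy, per single slab-ordered real factor datum, a diagonal
  bound with a free constant eventually in `k` with slack `ε`, then `T.HasMassGap Δ`;
  `IsYangMillsFor.hasMassGap_of_diagClustering` is the Yang–Mills instance (strictly weaker
  hypothesis than `sch.HasCSClustering r Δ` of `IsYangMillsFor.hasMassGap_of_hasCSClustering`).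

References: K. Osterwalder, R. Schrader, CMP 31 (1973) §4.1 (4.3)–(4.9) [OsterwalderSchraderCMP1973];
J. Glimm, A. Jaffe, *Quantum Physics* (1987) §6.1 Thm. 6.1.3 [GlimmJaffeQP1987];
K. Osterwalder, E. Seiler, Ann. Phys. 110 (1978) §§2–4 [OsterwalderSeiler1978];
A. Jaffe, E. Witten, *Quantum Yang–Mills theory* (2000) §4–§5 [JaffeWitten2000].
Mathlib: `Submodule.mem_span_set'`, `le_of_tendsto_of_tendsto`, `le_of_forall_pos_le_add`.
Tree: `OSData.hasMassGap_of_csBound_span`, `apply_osAdjoint_appendTensor_sum_smul`,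
`apply_osAdjoint_sum_smul`, `apply_sum_smul`, `IsTimeOrdered.of_mem_slabOrderedProducts`,
`exists_isSlabOrdered_of_mem_slabOrderedProducts`, `append_ofRealTest`.
-/

open scoped SchwartzMap ComplexConjugate InnerProductSpace
open Filter Topology Complex Set
open Literature.MathematicalPhysics.AQFT Literature.MathematicalPhysics.QuantumLattice

noncomputable section

namespace Literature.MathematicalPhysics.QuantumFieldTheory

/-! ### The full-spectrum gap from diagonal bounds with free constants -/

namespace OSData

variable {ι : Type} {d : ℕ} [NeZero d] {n m : ℕ}

/-- **Full-spectrum gap from DIAGONAL bounds with FREE constants** (`d ≥ 2`).  If for every arity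
`n ≥ 1`, every label string `k` and every slab-ordered real product tensor `P` there is SOME constant
`C` with `‖𝔖₂ₙ^{rev k ++ k}(ΘP* ⊗ T_t P) − 𝔖ₙ^{rev k}(ΘP*) 𝔖ₙ^{k}(P)‖ ≤ C e^{−Δt}` for all `t ≥ 0`,
then `T.HasMassGap Δ`.  In the OS Hilbert space the diagonal quantity is `⟨v, e^{−tH} v⟩` for the
vacuum-projected field vector `v = Ψ_P − ⟨Ω,Ψ_P⟩Ω`; log-convexity with infinite horizon self-improves
the constant to `‖v‖²`, the improved bound passes to the span, Cauchy–Schwarz gives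
`|⟨v, e^{−tH} w⟩| ≤ e^{−Δt}‖v‖‖w‖ ≤ e^{−Δt}‖Ψ_F‖‖Ψ_G‖`, and `hasMassGap_of_csBound_span` concludes.
[cite: GlimmJaffeQP1987, §6.1 Thm. 6.1.3] [cite: OsterwalderSchraderCMP1973, §4.1 eqs. (4.3)–(4.9)] -/
theorem hasMassGap_of_diagBound (T : OSData ι d) (hd : 1 < d) (Δ : ℝ)
    (hdiag : ∀ (n : ℕ), n ≠ 0 → ∀ (k : Fin n → ι) (P : 𝓢((Fin n → EuclideanSpace ℝ (Fin d)), ℂ)),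
      P ∈ slabOrderedProducts d n → ∃ C : ℝ, ∀ t : ℝ, 0 ≤ t →
        ‖T.schwinger (n + n) (Fin.append (k ∘ Fin.rev) k)
              ((osAdjoint P).appendTensor (translateMulti (EuclideanSpace.single 0 t) P)) -
            T.schwinger n (k ∘ Fin.rev) (osAdjoint P) * T.schwinger n k P‖ ≤
          C * Real.exp (-Δ * t)) :
    T.HasMassGap Δ := by
  have hOS : OSReconstructionNoE1 T.schwinger := OSReconstructionNoE1.of_osAxioms T.osAxioms
  have h0 : T.schwinger.IsNormalized := T.normalized
  -- (1) the vacuum-projected field vector of ONE slab-ordered real product tensor obeys the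
  --     improved bound (self-improvement of the free constant)
  have hgood : ∀ (n : ℕ), n ≠ 0 → ∀ (k : Fin n → ι)
      (P : 𝓢((Fin n → EuclideanSpace ℝ (Fin d)), ℂ)) (hP : P ∈ slabOrderedProducts d n) (t : ℝ),
      0 ≤ t →
      (⟪hOS.fieldVec n k P (IsTimeOrdered.of_mem_slabOrderedProducts hP) -
            ⟪hOS.vacuum, hOS.fieldVec n k P (IsTimeOrdered.of_mem_slabOrderedProducts hP)⟫_ℂ •
              hOS.vacuum,
          hOS.transfer t
            (hOS.fieldVec n k P (IsTimeOrdered.of_mem_slabOrderedProducts hP) -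
              ⟪hOS.vacuum, hOS.fieldVec n k P (IsTimeOrdered.of_mem_slabOrderedProducts hP)⟫_ℂ •
                hOS.vacuum)⟫_ℂ).re ≤
        ‖hOS.fieldVec n k P (IsTimeOrdered.of_mem_slabOrderedProducts hP) -
            ⟪hOS.vacuum, hOS.fieldVec n k P (IsTimeOrdered.of_mem_slabOrderedProducts hP)⟫_ℂ •
              hOS.vacuum‖ ^ 2 * Real.exp (-Δ * t) := by
    intro n hn k P hP
    obtain ⟨C, hC⟩ := hdiag n hn k P hP
    have hPt : IsTimeOrdered P := IsTimeOrdered.of_mem_slabOrderedProducts hP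
    refine fun t ht => hOS.re_inner_transfer_self_le_of_le_exp (C := C) (fun s hs => ?_) ht
    rw [hOS.inner_proj_transfer_proj h0, hOS.inner_fieldVec_transfer_fieldVec k k hPt hPt hs,
      hOS.inner_fieldVec_vacuum, hOS.inner_vacuum_fieldVec]
    exact (le_abs_self _).trans ((Complex.abs_re_le_norm _).trans (hC s hs))
  -- (2) the Cauchy–Schwarz bound on span × span
  refine hasMassGap_of_csBound_span T hd Δ fun n m hn hm k k' F G hF hG t ht => ?_
  obtain ⟨N, c, g, rfl⟩ := Submodule.mem_span_set'.1 hF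
  obtain ⟨N', c', g', rfl⟩ := Submodule.mem_span_set'.1 hG
  have hPi : ∀ i, IsTimeOrdered (g i : 𝓢((Fin n → EuclideanSpace ℝ (Fin d)), ℂ)) := fun i =>
    IsTimeOrdered.of_mem_slabOrderedProducts (g i).2
  have hQj : ∀ j, IsTimeOrdered (g' j : 𝓢((Fin m → EuclideanSpace ℝ (Fin d)), ℂ)) := fun j =>
    IsTimeOrdered.of_mem_slabOrderedProducts (g' j).2
  -- the OS vectors of `F = ∑ cᵢ Pᵢ` and `G = ∑ c'ⱼ Qⱼ`
  set V : hOS.Hilbert := ∑ i, c i • hOS.fieldVec n k (g i) (hPi i) with hV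
  set W : hOS.Hilbert := ∑ j, c' j • hOS.fieldVec m k' (g' j) (hQj j) with hW
  clear_value V W
  -- (3) matrix elements of `V, W` are the Schwinger functions of `F, G`
  have hVW : ⟪V, hOS.transfer t W⟫_ℂ = T.schwinger (n + m) (Fin.append (k ∘ Fin.rev) k')
      ((osAdjoint (∑ i, c i • (g i : 𝓢((Fin n → EuclideanSpace ℝ (Fin d)), ℂ)))).appendTensor
        (translateMulti (EuclideanSpace.single 0 t)
          (∑ j, c' j • (g' j : 𝓢((Fin m → EuclideanSpace ℝ (Fin d)), ℂ))))) := by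
    rw [map_sum (translateMulti (EuclideanSpace.single (0 : Fin d) t)),
      Finset.sum_congr rfl fun j _ =>
        map_smul (translateMulti (EuclideanSpace.single (0 : Fin d) t)) _ _,
      apply_osAdjoint_appendTensor_sum_smul, hV, hW, map_sum (hOS.transfer t), sum_inner]
    refine Finset.sum_congr rfl fun i _ => ?_
    rw [inner_sum]
    refine Finset.sum_congr rfl fun j _ => ?_
    rw [map_smul, inner_smul_left, inner_smul_right,
      hOS.inner_fieldVec_transfer_fieldVec k k' (hPi i) (hQj j) ht]
    ring
  have hVΩ : ⟪V, hOS.vacuum⟫_ℂ = T.schwinger n (k ∘ Fin.rev)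
      (osAdjoint (∑ i, c i • (g i : 𝓢((Fin n → EuclideanSpace ℝ (Fin d)), ℂ)))) := by
    rw [apply_osAdjoint_sum_smul, hV, sum_inner]
    refine Finset.sum_congr rfl fun i _ => ?_
    rw [inner_smul_left, hOS.inner_fieldVec_vacuum k (hPi i)]
  have hΩW : ⟪hOS.vacuum, W⟫_ℂ = T.schwinger m k'
      (∑ j, c' j • (g' j : 𝓢((Fin m → EuclideanSpace ℝ (Fin d)), ℂ))) := by
    rw [apply_sum_smul, hW, inner_sum]
    refine Finset.sum_congr rfl fun j _ => ?_
    rw [inner_smul_right, hOS.inner_vacuum_fieldVec k' (hQj j)]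
  have hVV : ⟪V, V⟫_ℂ = T.schwinger (n + n) (Fin.append (k ∘ Fin.rev) k)
      ((osAdjoint (∑ i, c i • (g i : 𝓢((Fin n → EuclideanSpace ℝ (Fin d)), ℂ)))).appendTensor
        (∑ i, c i • (g i : 𝓢((Fin n → EuclideanSpace ℝ (Fin d)), ℂ)))) := by
    rw [apply_osAdjoint_appendTensor_sum_smul, hV, sum_inner]
    refine Finset.sum_congr rfl fun i _ => ?_
    rw [inner_sum]
    refine Finset.sum_congr rfl fun i' _ => ?_
    rw [inner_smul_left, inner_smul_right, hOS.inner_fieldVec_fieldVec_same k (hPi i) (hPi i')]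
    ring
  have hWW : ⟪W, W⟫_ℂ = T.schwinger (m + m) (Fin.append (k' ∘ Fin.rev) k')
      ((osAdjoint (∑ j, c' j • (g' j : 𝓢((Fin m → EuclideanSpace ℝ (Fin d)), ℂ)))).appendTensor
        (∑ j, c' j • (g' j : 𝓢((Fin m → EuclideanSpace ℝ (Fin d)), ℂ)))) := by
    rw [apply_osAdjoint_appendTensor_sum_smul, hW, sum_inner]
    refine Finset.sum_congr rfl fun j _ => ?_
    rw [inner_sum]
    refine Finset.sum_congr rfl fun j' _ => ?_
    rw [inner_smul_left, inner_smul_right, hOS.inner_fieldVec_fieldVec_same k' (hQj j) (hQj j')]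
    ring
  have hnV : Real.sqrt ‖T.schwinger (n + n) (Fin.append (k ∘ Fin.rev) k)
      ((osAdjoint (∑ i, c i • (g i : 𝓢((Fin n → EuclideanSpace ℝ (Fin d)), ℂ)))).appendTensor
        (∑ i, c i • (g i : 𝓢((Fin n → EuclideanSpace ℝ (Fin d)), ℂ))))‖ = ‖V‖ := by
    rw [← hVV, inner_self_eq_norm_sq_to_K, norm_pow, RCLike.norm_ofReal, abs_norm,
      Real.sqrt_sq (norm_nonneg _)]
  have hnW : Real.sqrt ‖T.schwinger (m + m) (Fin.append (k' ∘ Fin.rev) k')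
      ((osAdjoint (∑ j, c' j • (g' j : 𝓢((Fin m → EuclideanSpace ℝ (Fin d)), ℂ)))).appendTensor
        (∑ j, c' j • (g' j : 𝓢((Fin m → EuclideanSpace ℝ (Fin d)), ℂ))))‖ = ‖W‖ := by
    rw [← hWW, inner_self_eq_norm_sq_to_K, norm_pow, RCLike.norm_ofReal, abs_norm,
      Real.sqrt_sq (norm_nonneg _)]
  -- (4) the vacuum-projected vectors lie in the span of the projected `Ψᵢ`, hence are good
  have hpV : V - ⟪hOS.vacuum, V⟫_ℂ • hOS.vacuum = ∑ i, c i •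
      (hOS.fieldVec n k (g i) (hPi i) - ⟪hOS.vacuum, hOS.fieldVec n k (g i) (hPi i)⟫_ℂ •
        hOS.vacuum) := by
    rw [hV]
    simp only [inner_sum, inner_smul_right, Finset.sum_smul, smul_sub, smul_smul,
      Finset.sum_sub_distrib]
  have hpW : W - ⟪hOS.vacuum, W⟫_ℂ • hOS.vacuum = ∑ j, c' j •
      (hOS.fieldVec m k' (g' j) (hQj j) - ⟪hOS.vacuum, hOS.fieldVec m k' (g' j) (hQj j)⟫_ℂ •
        hOS.vacuum) := by
    rw [hW]
    simp only [inner_sum, inner_smul_right, Finset.sum_smul, smul_sub, smul_smul,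
      Finset.sum_sub_distrib]
  have hgoodV : ∀ s : ℝ, 0 ≤ s →
      (⟪V - ⟪hOS.vacuum, V⟫_ℂ • hOS.vacuum,
          hOS.transfer s (V - ⟪hOS.vacuum, V⟫_ℂ • hOS.vacuum)⟫_ℂ).re ≤
        ‖V - ⟪hOS.vacuum, V⟫_ℂ • hOS.vacuum‖ ^ 2 * Real.exp (-Δ * s) := by
    rw [hpV]
    exact fun s hs => hOS.re_inner_transfer_self_le_sum c
      (fun i => hOS.fieldVec n k (g i) (hPi i) -
        ⟪hOS.vacuum, hOS.fieldVec n k (g i) (hPi i)⟫_ℂ • hOS.vacuum)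
      (fun i => hgood n hn k _ (g i).2) hs
  have hgoodW : ∀ s : ℝ, 0 ≤ s →
      (⟪W - ⟪hOS.vacuum, W⟫_ℂ • hOS.vacuum,
          hOS.transfer s (W - ⟪hOS.vacuum, W⟫_ℂ • hOS.vacuum)⟫_ℂ).re ≤
        ‖W - ⟪hOS.vacuum, W⟫_ℂ • hOS.vacuum‖ ^ 2 * Real.exp (-Δ * s) := by
    rw [hpW]
    exact fun s hs => hOS.re_inner_transfer_self_le_sum c'
      (fun j => hOS.fieldVec m k' (g' j) (hQj j) -
        ⟪hOS.vacuum, hOS.fieldVec m k' (g' j) (hQj j)⟫_ℂ • hOS.vacuum)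
      (fun j => hgood m hm k' _ (g' j).2) hs
  -- (5) Cauchy–Schwarz for the projected vectors, and `‖v‖ ≤ ‖Ψ‖`
  have hid : ⟪V - ⟪hOS.vacuum, V⟫_ℂ • hOS.vacuum,
      hOS.transfer t (W - ⟪hOS.vacuum, W⟫_ℂ • hOS.vacuum)⟫_ℂ =
      T.schwinger (n + m) (Fin.append (k ∘ Fin.rev) k')
          ((osAdjoint (∑ i, c i • (g i : 𝓢((Fin n → EuclideanSpace ℝ (Fin d)), ℂ)))).appendTensor
            (translateMulti (EuclideanSpace.single 0 t)
              (∑ j, c' j • (g' j : 𝓢((Fin m → EuclideanSpace ℝ (Fin d)), ℂ))))) -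
        T.schwinger n (k ∘ Fin.rev)
            (osAdjoint (∑ i, c i • (g i : 𝓢((Fin n → EuclideanSpace ℝ (Fin d)), ℂ)))) *
          T.schwinger m k' (∑ j, c' j • (g' j : 𝓢((Fin m → EuclideanSpace ℝ (Fin d)), ℂ))) := by
    rw [hOS.inner_proj_transfer_proj h0, hVW, hVΩ, hΩW]
  have key := hOS.norm_inner_transfer_le_of_le_exp hgoodV hgoodW ht
  rw [hid] at key
  rw [hnV, hnW]
  calc _ ≤ Real.exp (-Δ * t) * ‖V - ⟪hOS.vacuum, V⟫_ℂ • hOS.vacuum‖ *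
        ‖W - ⟪hOS.vacuum, W⟫_ℂ • hOS.vacuum‖ := key
    _ ≤ Real.exp (-Δ * t) * ‖V‖ * ‖W‖ := by
        have hE : 0 ≤ Real.exp (-Δ * t) := (Real.exp_pos _).le
        have h1 := hOS.norm_sub_inner_vacuum_smul_le h0 V
        have h2 := hOS.norm_sub_inner_vacuum_smul_le h0 W
        exact mul_le_mul (mul_le_mul_of_nonneg_left h1 hE) h2 (norm_nonneg _) (by positivity)

/-! ### Lattice-facing form: diagonal clustering of a lattice approximation, free constants -/

/-- **The transfer from a lattice approximation, diagonal form.**  If `Λ k → 𝔖` on the off-diagonal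
real product tensors of every degree `n ≥ 1` (the convergence clause of `IsQCDAlong` /
`IsYangMillsFor`) and for every arity `n ≥ 1`, label string `σ` and ONE slab-ordered real factor datum
`p` there is a constant `C` such that for all `t ≥ 0` and `ε > 0`, EVENTUALLY in `k`,
`‖Λᵏ₂ₙ(θpʳ ++ T_t p) − Λᵏₙ(θpʳ) Λᵏₙ(p)‖ ≤ C e^{−Δt} + ε` (the diagonal `N = N' = 1` instance of
`ClustersCS` with the Cauchy–Schwarz right-hand side replaced by a FREE constant), then
`T.HasMassGap Δ` (`d ≥ 2`): termwise limits, `ε → 0`, then `hasMassGap_of_diagBound`.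
[cite: GlimmJaffeQP1987, §6.1 Thm. 6.1.3] [cite: OsterwalderSeiler1978, §§2–4] -/
theorem hasMassGap_of_tendsto_of_diagBound (T : OSData ι d) (hd : 1 < d)
    (Λ : ℕ → (n : ℕ) → (Fin n → ι) → (Fin n → 𝓢(EuclideanSpace ℝ (Fin d), ℝ)) → ℂ)
    (hΛ : ∀ (n : ℕ), n ≠ 0 → ∀ (σ : Fin n → ι) (f : Fin n → 𝓢(EuclideanSpace ℝ (Fin d), ℝ))
      (F : 𝓢((Fin n → EuclideanSpace ℝ (Fin d)), ℂ)), IsTensorOf F (fun i => ofRealTest (f i)) →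
      IsOffDiagonal F → Tendsto (fun k => Λ k n σ f) atTop (𝓝 (T.schwinger n σ F)))
    {Δ : ℝ}
    (hdiag : ∀ (n : ℕ), n ≠ 0 → ∀ (σ : Fin n → ι) (p : Fin n → 𝓢(EuclideanSpace ℝ (Fin d), ℝ)),
      IsSlabOrdered p → ∃ C : ℝ, ∀ t : ℝ, 0 ≤ t → ∀ ε : ℝ, 0 < ε → ∀ᶠ k in atTop,
        ‖Λ k (n + n) (Fin.append (σ ∘ Fin.rev) σ)
              (Fin.append (fun l => thetaTest d (p (Fin.rev l)))
                (fun l => translateTest (EuclideanSpace.single 0 t) (p l))) -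
            Λ k n (σ ∘ Fin.rev) (fun l => thetaTest d (p (Fin.rev l))) * Λ k n σ p‖ ≤
          C * Real.exp (-Δ * t) + ε) :
    T.HasMassGap Δ := by
  refine hasMassGap_of_diagBound T hd Δ fun n hn σ P hP => ?_
  obtain ⟨p, hpT, hp⟩ := exists_isSlabOrdered_of_mem_slabOrderedProducts hP
  obtain ⟨C, hC⟩ := hdiag n hn σ p hp
  have hPt : IsTimeOrdered P := IsTimeOrdered.of_mem_slabOrderedProducts hP
  refine ⟨C, fun t ht => ?_⟩
  set a : EuclideanSpace ℝ (Fin d) := EuclideanSpace.single 0 t with ha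
  -- the three lattice quantities converge to their continuum counterparts
  have hA : Tendsto (fun k => Λ k (n + n) (Fin.append (σ ∘ Fin.rev) σ)
        (Fin.append (fun l => thetaTest d (p (Fin.rev l))) (fun l => translateTest a (p l))))
      atTop (𝓝 (T.schwinger (n + n) (Fin.append (σ ∘ Fin.rev) σ)
        ((osAdjoint P).appendTensor (translateMulti a P)))) := by
    refine hΛ (n + n) (by omega) _ _ _ ?_ ?_
    · have h1 := hpT.osAdjoint.appendTensor (hpT.translateMulti a)
      rwa [append_ofRealTest] at h1
    · exact OSReconstructionNoE1.isOffDiagonal_appendTensor_osAdjoint hPt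
        (OSReconstructionNoE1.isTimeOrdered_translateMulti hPt (by simp [ha, ht]))
  have hB : Tendsto (fun k => Λ k n (σ ∘ Fin.rev) (fun l => thetaTest d (p (Fin.rev l))))
      atTop (𝓝 (T.schwinger n (σ ∘ Fin.rev) (osAdjoint P))) :=
    hΛ n hn _ _ _ hpT.osAdjoint hPt.isOffDiagonal.osAdjoint
  have hC' : Tendsto (fun k => Λ k n σ p) atTop (𝓝 (T.schwinger n σ P)) :=
    hΛ n hn _ _ _ hpT hPt.isOffDiagonal
  have hlim := (hA.sub (hB.mul hC')).norm
  refine le_of_forall_pos_le_add fun ε hε => ?_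
  exact le_of_tendsto_of_tendsto hlim tendsto_const_nhds (hC t ht ε hε)

end OSData

/-! ### The Yang–Mills instance -/

section YangMills

variable {G : Type} [Group G] [MeasurableSpace G] [TopologicalSpace G] [IsTopologicalGroup G]
  [CompactSpace G] [BorelSpace G]

/-- **Continuum gap clause of Yang–Mills from DIAGONAL clustering with free constants**:
`IsYangMillsFor r sch T` and, for every arity `n ≥ 1`, species string `σ` and one slab-ordered
real factor datum `p`, a bound `‖Λᵏ₂ₙ(θpʳ ++ T_t p) − Λᵏₙ(θpʳ)Λᵏₙ(p)‖ ≤ C e^{−Δt} + ε` eventually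
in `k` (every `t ≥ 0`, `ε > 0`; `Λᵏ` the lattice `n`-point functions `latticeSchwinger r.ρ sch` of
the smeared renormalised gauge-invariant local observables on the scheme's own tori) give
`T.HasMassGap Δ`.  Weaker hypothesis than `sch.HasCSClustering r Δ` of
`IsYangMillsFor.hasMassGap_of_hasCSClustering` (no finite families, no Cauchy–Schwarz form).
[cite: JaffeWitten2000, §4–§5] [cite: OsterwalderSeiler1978, §§2–4] -/
theorem IsYangMillsFor.hasMassGap_of_diagClustering {r : LatticeRep G}
    {sch : SpeciesScheme (YMSpecies G)} {T : OSData (YMSpecies G) 4} (hT : IsYangMillsFor r sch T)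
    {Δ : ℝ}
    (hdiag : ∀ (n : ℕ), n ≠ 0 → ∀ (σ : Fin n → YMSpecies G)
      (p : Fin n → 𝓢(EuclideanSpace ℝ (Fin 4), ℝ)), IsSlabOrdered p →
      ∃ C : ℝ, ∀ t : ℝ, 0 ≤ t → ∀ ε : ℝ, 0 < ε → ∀ᶠ k in atTop,
        ‖((latticeSchwinger r.ρ sch (fun s => s.F) k (n + n) (Fin.append (σ ∘ Fin.rev) σ)
              (Fin.append (fun l => thetaTest 4 (p (Fin.rev l)))
                (fun l => translateTest (EuclideanSpace.single 0 t) (p l))) : ℝ) : ℂ) -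
            ((latticeSchwinger r.ρ sch (fun s => s.F) k n (σ ∘ Fin.rev)
                (fun l => thetaTest 4 (p (Fin.rev l))) : ℝ) : ℂ) *
              ((latticeSchwinger r.ρ sch (fun s => s.F) k n σ p : ℝ) : ℂ)‖ ≤
          C * Real.exp (-Δ * t) + ε) :
    T.HasMassGap Δ :=
  OSData.hasMassGap_of_tendsto_of_diagBound T (by norm_num)
    (fun k n σ f => ((latticeSchwinger r.ρ sch (fun s => s.F) k n σ f : ℝ) : ℂ)) hT hdiag

end YangMills

/-! ### Variant: the diagonal bound at large times only -/

namespace OSData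

variable {ι : Type} {d : ℕ} [NeZero d]

/-- **Large times suffice.**  In `hasMassGap_of_diagBound` the diagonal bound for the tensor `P` is
only needed for `t ≥ t₀(P)` (any `t₀`, free constant): for `0 ≤ t < t₀` the diagonal quantity is
`⟨v, e^{−tH}v⟩` with `v = Ψ_P − ⟨Ω,Ψ_P⟩Ω`, of modulus `≤ ‖v‖²` (contraction), which is absorbed into the
constant. [cite: GlimmJaffeQP1987, §6.1 Thm. 6.1.3] -/
theorem hasMassGap_of_diagBound_largeTime (T : OSData ι d) (hd : 1 < d) (Δ : ℝ)
    (hdiag : ∀ (n : ℕ), n ≠ 0 → ∀ (k : Fin n → ι) (P : 𝓢((Fin n → EuclideanSpace ℝ (Fin d)), ℂ)),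
      P ∈ slabOrderedProducts d n → ∃ C t₀ : ℝ, ∀ t : ℝ, t₀ ≤ t → 0 ≤ t →
        ‖T.schwinger (n + n) (Fin.append (k ∘ Fin.rev) k)
              ((osAdjoint P).appendTensor (translateMulti (EuclideanSpace.single 0 t) P)) -
            T.schwinger n (k ∘ Fin.rev) (osAdjoint P) * T.schwinger n k P‖ ≤
          C * Real.exp (-Δ * t)) :
    T.HasMassGap Δ := by
  have hOS : OSReconstructionNoE1 T.schwinger := OSReconstructionNoE1.of_osAxioms T.osAxioms
  have h0 : T.schwinger.IsNormalized := T.normalized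
  refine hasMassGap_of_diagBound T hd Δ fun n hn k P hP => ?_
  obtain ⟨C, t₀, hC⟩ := hdiag n hn k P hP
  have hPt : IsTimeOrdered P := IsTimeOrdered.of_mem_slabOrderedProducts hP
  set v : hOS.Hilbert := hOS.fieldVec n k P hPt - ⟪hOS.vacuum, hOS.fieldVec n k P hPt⟫_ℂ • hOS.vacuum
    with hv
  -- the diagonal quantity is `⟨v, e^{-tH} v⟩`, of modulus `≤ ‖v‖²`
  have hid : ∀ t : ℝ, 0 ≤ t →
      T.schwinger (n + n) (Fin.append (k ∘ Fin.rev) k)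
          ((osAdjoint P).appendTensor (translateMulti (EuclideanSpace.single 0 t) P)) -
        T.schwinger n (k ∘ Fin.rev) (osAdjoint P) * T.schwinger n k P = ⟪v, hOS.transfer t v⟫_ℂ := by
    intro t ht
    rw [hv, hOS.inner_proj_transfer_proj h0, hOS.inner_fieldVec_transfer_fieldVec k k hPt hPt ht,
      hOS.inner_fieldVec_vacuum, hOS.inner_vacuum_fieldVec]
  have hbd : ∀ t : ℝ, ‖⟪v, hOS.transfer t v⟫_ℂ‖ ≤ ‖v‖ ^ 2 := fun t =>
    (norm_inner_le_norm _ _).trans (by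
      rw [sq]; exact mul_le_mul_of_nonneg_left (hOS.norm_transfer_le t v) (norm_nonneg _))
  refine ⟨max C 0 + ‖v‖ ^ 2 * Real.exp (|Δ| * |t₀|), fun t ht => ?_⟩
  have hE : 0 ≤ Real.exp (-Δ * t) := (Real.exp_pos _).le
  have hK : 0 ≤ ‖v‖ ^ 2 * Real.exp (|Δ| * |t₀|) := by positivity
  rcases le_or_gt t₀ t with hle | hlt
  · calc _ ≤ C * Real.exp (-Δ * t) := hC t hle ht
      _ ≤ (max C 0 + ‖v‖ ^ 2 * Real.exp (|Δ| * |t₀|)) * Real.exp (-Δ * t) :=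
          mul_le_mul_of_nonneg_right ((le_max_left _ _).trans (le_add_of_nonneg_right hK)) hE
  · have h1 : (1 : ℝ) ≤ Real.exp (|Δ| * |t₀|) * Real.exp (-Δ * t) := by
      rw [← Real.exp_add]
      refine Real.one_le_exp ?_
      have h2 : Δ * t ≤ |Δ| * t := mul_le_mul_of_nonneg_right (le_abs_self Δ) ht
      have h3 : |Δ| * t ≤ |Δ| * |t₀| :=
        mul_le_mul_of_nonneg_left (hlt.le.trans (le_abs_self t₀)) (abs_nonneg Δ)
      linarith
    rw [hid t ht]
    calc ‖⟪v, hOS.transfer t v⟫_ℂ‖ ≤ ‖v‖ ^ 2 * 1 := by rw [mul_one]; exact hbd t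
      _ ≤ ‖v‖ ^ 2 * (Real.exp (|Δ| * |t₀|) * Real.exp (-Δ * t)) :=
          mul_le_mul_of_nonneg_left h1 (sq_nonneg _)
      _ = (‖v‖ ^ 2 * Real.exp (|Δ| * |t₀|)) * Real.exp (-Δ * t) := by ring
      _ ≤ (max C 0 + ‖v‖ ^ 2 * Real.exp (|Δ| * |t₀|)) * Real.exp (-Δ * t) :=
          mul_le_mul_of_nonneg_right (le_add_of_nonneg_left (le_max_right _ _)) hE

end OSData

end Literature.MathematicalPhysics.QuantumFieldTheory

end
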